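import Summits.HodgeConjecture.HodgeConjecture.Theorems.MarkmanPartnerTransportRMTypeDefs
import Summits.HodgeConjecture.HodgeConjecture.Theorems.MarkmanPartnerTransportPicardThreeK3SquaresIsogenousRepresentative
import Summits.HodgeConjecture.HodgeConjecture.Theorems.MarkmanPartnerTransportPicardThreeK3SquaresRMSpread
import Literature.AlgebraicGeometry.Surfaces.K3PeriodSurjectivityProofs
import HarnessLib

/-!
# Route MarkmanPartnerTransport · cruxes `PicardThreeK3Squares` (stmt-HodgeConjecture-19652) ∕
# `LowPicardRealMultiplication` (stmt-19653) — W3-T «RM-TYPE DESCENT»: the displayed moduli input for ONE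
# rational real-multiplication type gives HC⁴(S × S) for EVERY K3 surface of that rational type

Cell hodge-nonav, planner p1 g36 (memo ROUTE-P1AI §A, Sketch `HOME/p1/route/Sketch_RMTypeDescent_g36.lean`
sha16 5ed8641ea7572ca4; assignment 2026-08-28T08:53:04Z), prover seat 20241-p1 (g12). SUPPORT FILE
(`--supports stmt-HodgeConjecture-19652`, helper): CONDITIONAL on the named facts
`Buskin2019_hodgeIsometry_algebraic`, `Huybrechts_K3_periodSurjective_projective` and the DISPLAYED
moduli input `RMTypeDominated θ` (`…RMTypeDefs`); credits nothing; nothing here says HC is proved.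

THEOREM `hodgeConjectureFor_square_of_rmTypeDominated` (the Sketch's (T), binders verbatim). For an RM K3
surface `S` marked by `(η, p, x)`, with admissible generator `t` of `End_Hdg T(S)` which a rational
isometry `σ ∈ O(Λ_ℚ)` conjugates, in the marking, to the self-adjoint model endomorphism `θ`
(`σ ∘ η ∘ t = θ_ℂ ∘ σ ∘ η`): if the rational type `θ` is dominated (`RMTypeDominated θ`), then
`HodgeConjectureFor 4 (S ⊗ S)`.

PROOF (route 5′ of the memo — the RM structure stays on `S`, only the CYCLE moves):
(a) the period `σ x` is again a projective period, so a marked projective K3 surface `(S', η', p', σ x)`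
exists (`IsogenyInvariance.exists_markedK3_ratIsometry`, mod period surjectivity); `σ` has a rational
isometric inverse `σ'` (`exists_inverse_ratIsometry`);
(b) `θ_ℂ (σ x) = e' σ x`: `t` preserves the `(2,0)`-line `ℂ η⁻¹x` (marking clause + `ht_typ`), and `hconj`;
(c) `σ x` is `θ`-GENERIC: a rational `v ⊥ σ x` gives the rational class `c = η⁻¹(σ' v) ⊥ x`, of type
`(1,1)` (`Huybrechts_K3_hodgeTypes_H2_holds`; `⊥ x̄` because `σ' v` is real), algebraic by Lefschetz
`(1,1)` (`lefschetzOneOne_rational_holds`), hence killed by `t` (`ht_N`), whence `θ v = σ η t c = 0` by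
`hconj`;
(d) `RMTypeDominated θ` now gives an `RMSpreadFamily` on `S'` for `t' = η'⁻¹ θ_ℂ η'`, so `t'` is induced
EVERYWHERE by an algebraic class `γ'` on `S' × S'` (`RMSpreadFamily.exists_algebraicClass'` — unconditional:
Deligne 1968 is a tree theorem);
(e) the marking-conjugated maps `ψ = η'⁻¹ σ η : H²(S) → H²(S')`, `φ = η⁻¹ σ' η' : H²(S') → H²(S)` are
rational Hodge isometries (`isRationalClass_markingConj`, `isOfHodgeType_markingConj`,
`cupProduct_markingConj`), hence induced by algebraic classes (Buskin, at `complexOrientationFamily`);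
(f) `t = φ ∘ t' ∘ ψ` on ALL of `H²(S)` (`hconj`, `σ'σ = 1`), so `t` is induced by the composite
correspondence (`corrComp_K3_of_cup` twice, multiplicativity `SquareOfGenerator.cupProduct_mem_algebraicClasses_tripleProduct`);
(g) `SquareOfGenerator.squareOfGenerator` (Varesco's bookkeeping over `ℚ[t]`, `hgen`) concludes.
No sector clause and no transport of the generation hypothesis is needed; `hP`, `ht_perp` and the RM
numerics of `h` are carried for the signature only (`h` supplies `IsK3Surface S`).

References: van Geemen–Schütt, Forum Math. Sigma 13 (2025) e2, §3.4, §4.8; Buskin, J. reine angew. Math.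
755 (2019), Thm. 1.1, §6.2 Lemma 6.3; Huybrechts, *Lectures on K3 Surfaces*, Ch. 6 Prop. 1.2, Rem. 3.3,
Ch. 7 Thm. 4.1; Varesco, Math. Z. 305 (2023) art. 69, §2; Voisin, *Hodge Theory I*, Thm. 11.30.
-/

set_option linter.dupNamespace false

noncomputable section

namespace Summit.HodgeConjecture.HodgeConjecture.Theorems.MarkmanPartnerTransport.RMTypeDescent

open CategoryTheory MonoidalCategory Polynomial
open Literature.AlgebraicGeometry Literature.AlgebraicGeometry.Motives Literature.AlgebraicGeometry.HodgeTheory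
open Literature.AlgebraicGeometry.Surfaces
open Literature.AlgebraicTopology.SingularHomology
open Summit.HodgeConjecture.HodgeConjecture.Theorems.NikulinTwinTransport
open Summit.HodgeConjecture.HodgeConjecture.Theorems.MarkmanPartnerTransport.IsogenyInvariance

/-- `MarkedK3[S, η, p, x]`: VERBATIM the `let MarkedK3 := …` binder of the route declaration
`PicardThreeK3Squares` (as in `…IsogenousRepresentative` and `…RMTypeDefs`). Local notation only. -/
local notation3 (prettyPrint := false) "MarkedK3[" S ", " η ", " p ", " x "]" =>
  (p ≠ 0 ∧ (IsIntegralClass p ∧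
    (∀ q : complexBetti S (2 * 2), IsIntegralClass q → ∃ n : ℤ, q = n • p) ∧
    (∀ c : complexBetti S (2 * 1), IsIntegralClass c ↔ ∃ v : K3Index → ℤ, η c = fun i => (v i : ℂ)) ∧
    (∀ a b : complexBetti S (2 * 1),
      cupProduct (rfl : 2 * 1 + 2 * 1 = 2 * 2) a b = k3Form (η a) (η b) • p) ∧
    IsOfHodgeType 2 S (2 * 1) 2 0 (LinearEquiv.symm η x) ∧
    (∀ τ : complexBetti S (2 * 1), IsOfHodgeType 2 S (2 * 1) 2 0 τ →
      ∃ t : ℂ, τ = t • LinearEquiv.symm η x)) ∧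
    (k3Form x x = 0 ∧ 0 < (k3Form (star x) x).re ∧
      ∃ u : K3Index → ℤ, k3Form (fun i => (u i : ℂ)) x = 0 ∧ 0 < ∑ i, ∑ j, u i * k3Gram i j * u j))

variable {S : SchemeOver ℂ}

/-- `θ_ℂ` on a rational vector is the rational vector `θ v`: `thetaC θ (v ⊗ 1) = (θ v) ⊗ 1`.
[cite: GeemenSchutt2023, §2.1] -/
theorem thetaC_ratCast (θ : Matrix K3Index K3Index ℚ) (v : K3Index → ℚ) :
    thetaC θ (fun i => (v i : ℂ)) = fun i => ((θ.mulVec v) i : ℂ) := by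
  funext i
  rw [thetaC, Matrix.toLin'_apply]
  have h := (RingHom.map_mulVec (algebraMap ℚ ℂ) θ v i).symm
  have hv : ((algebraMap ℚ ℂ) ∘ v) = fun i => (v i : ℂ) := funext fun j => eq_ratCast _ _
  rw [hv] at h
  rw [h, eq_ratCast]

/-- A rational vector of `Λ_ℂ` orthogonal to `x` is orthogonal to `x̄` (it is real and the K3 form is
defined over `ℤ`). [folklore] -/
private theorem k3Form_ratCast_star_eq_zero (w : K3Index → ℚ) {x : K3Index → ℂ}
    (hwx : k3Form (fun i => (w i : ℂ)) x = 0) : k3Form (fun i => (w i : ℂ)) (star x) = 0 := by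
  have hreal : star (fun i => (w i : ℂ)) = fun i => (w i : ℂ) := by
    funext i
    simp only [Pi.star_apply, Complex.star_def, map_ratCast]
  have h := congrArg star hwx
  rwa [star_k3Form, hreal, star_zero] at h

/-- **(T) RM-TYPE DESCENT** (planner p1 g36, memo ROUTE-P1AI §A; the Sketch's binders verbatim): for an RM
K3 surface `S` (`IsRealMultiplicationK3 S ρ P`) marked by `(η, p, x)`, an admissible generator `t` of
`End_Hdg T(S)` (rational, type-preserving, killing `N¹(S)`, image `⊥ N¹(S)`, `P(t) = 0` on `T`,
generating), and a rational isometry `σ ∈ O(Λ_ℚ)` conjugating `t` in the marking to the SELF-ADJOINT model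
endomorphism `θ` (`σ η t = θ_ℂ σ η`): if the rational type `θ` is dominated (`RMTypeDominated θ`, the ONE
displayed moduli input per rational RM type), then `HodgeConjectureFor 4 (S ⊗ S)`. Proof in the module
docstring: the cycle carrying `θ` on an isogenous marked K3 surface at the period `σ x` is transported back
to `S` along Buskin's algebraic isometries and composed; Varesco's bookkeeping over `ℚ[t]` concludes.
CONDITIONAL on {`Buskin2019_hodgeIsometry_algebraic`, `Huybrechts_K3_periodSurjective_projective`} and the
displayed `hDom`; credits nothing. [cite: GeemenSchutt2023, §3.4 and §4.8] [cite: Buskin2019, Thm. 1.1 and §6.2 Lemma 6.3]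
[cite: Huybrechts2016K3, Ch. 6 Prop. 1.2, Rem. 3.3 and Ch. 7 Thm. 4.1] [cite: Varesco2023, §2 (p. 8)] -/
theorem hodgeConjectureFor_square_of_rmTypeDominated
    (hB : Buskin2019_hodgeIsometry_algebraic) (hPS : Huybrechts_K3_periodSurjective_projective)
    {θ : Matrix K3Index K3Index ℚ} (hDom : RMTypeDominated θ)
    (hθsa : ∀ a b : K3Index → ℂ, k3Form (thetaC θ a) b = k3Form a (thetaC θ b))
    {S : SchemeOver ℂ} {ρ : ℕ} {P : ℚ[X]} (h : IsRealMultiplicationK3 S ρ P)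
    (η : complexBetti S (2 * 1) ≃ₗ[ℂ] (K3Index → ℂ)) (p : complexBetti S (2 * 2)) (x : K3Index → ℂ)
    (hM : MarkedK3[S, η, p, x])
    (t : complexBetti S (2 * 1) →ₗ[ℂ] complexBetti S (2 * 1))
    (ht_rat : ∀ y, IsRationalClass y → IsRationalClass (t y))
    (ht_typ : ∀ (i j : ℕ) (y : complexBetti S (2 * 1)),
      IsOfHodgeType 2 S (2 * 1) i j y → IsOfHodgeType 2 S (2 * 1) i j (t y))
    (ht_N : ∀ d ∈ algebraicClasses S 1, t d = 0)
    (_ht_perp : ∀ (y : complexBetti S (2 * 1)), ∀ d ∈ algebraicClasses S 1,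
      cupProduct (rfl : 2 * 1 + 2 * 1 = 2 * 2) (t y) d = 0)
    (_hP : IsAnnihilatedOnTranscendentalBy S t P) (hgen : TranscendentalEndomorphismsGeneratedBy S t)
    (σ : Module.End ℂ (K3Index → ℂ)) (hσ : ∀ a b, k3Form (σ a) (σ b) = k3Form a b)
    (hσrat : ∀ v : K3Index → ℤ, ∃ w : K3Index → ℚ, σ (fun i => (v i : ℂ)) = fun i => (w i : ℂ))
    (hconj : ∀ c : complexBetti S (2 * 1), σ (η (t c)) = thetaC θ (σ (η c))) :
    HodgeConjectureFor 4 (S ⊗ S) := by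
  classical
  have hS : IsK3Surface S := h.isK3Surface
  have hHT : Huybrechts_K3_hodgeTypes_H2 := Huybrechts_K3_hodgeTypes_H2_holds
  obtain ⟨hp0, ⟨hpint, hpgen, hηint, hηcup, h20, hline⟩, hPer⟩ := hM
  have hxpos : 0 < (k3Form (star x) x).re := hPer.2.1
  have hx0 : η.symm x ≠ 0 := fun h0 =>
    ne_zero_of_star_self_re_pos hxpos (by simpa using congrArg η h0)
  -- (a) the inverse isometry and a marked projective K3 surface at the period `σ x`
  obtain ⟨σ', hσσ', hσ'σ, hσ', hσ'rat⟩ := exists_inverse_ratIsometry σ hσ hσrat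
  obtain ⟨S', hS', η', p', hM'⟩ := exists_markedK3_ratIsometry hPS σ hσ hσrat hPer
  obtain ⟨hp'0, ⟨hp'int, hp'gen, hη'int, hη'cup, h20', hline'⟩, hPer'⟩ := hM'
  have hx'pos : 0 < (k3Form (star (σ x)) (σ x)).re := hPer'.2.1
  -- (b) the period `σ x` is a `θ_ℂ`-eigenvector
  obtain ⟨e', he'⟩ := hline (t (η.symm x)) (ht_typ 2 0 _ h20)
  have heig : thetaC θ (σ x) = e' • σ x := by
    have h1 := hconj (η.symm x)
    rw [he', map_smul, LinearEquiv.apply_symm_apply, map_smul] at h1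
    exact h1.symm
  -- (c) `σ x` is `θ`-generic
  have hgenσ : ∀ v : K3Index → ℚ, k3Form (fun i => (v i : ℂ)) (σ x) = 0 → θ.mulVec v = 0 := by
    intro v hv
    obtain ⟨w, hw⟩ := ratEnd_ratCast σ' hσ'rat v
    have hwx : k3Form (fun i => (w i : ℂ)) x = 0 := by
      rw [← hw, ← hσ (σ' _) x, hσσ']
      exact hv
    have hcrat : IsRationalClass (η.symm fun i => (w i : ℂ)) :=
      (isRationalClass_iff_of_marking hS η hηint _).2 ⟨w, η.apply_symm_apply _⟩
    have hc11 : IsOfHodgeType 2 S (2 * 1) 1 1 (η.symm fun i => (w i : ℂ)) := by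
      obtain ⟨-, -, h3⟩ := hHT S hS (η.symm x) h20 hx0
      refine (h3 _).2 ⟨?_, ?_⟩
      · rw [hηcup, η.apply_symm_apply, η.apply_symm_apply, hwx, zero_smul]
      · rw [conjClass_marking_symm η hηint, hηcup, η.apply_symm_apply, η.apply_symm_apply,
          k3Form_ratCast_star_eq_zero w hwx, zero_smul]
    have hcalg : (η.symm fun i => (w i : ℂ)) ∈ algebraicClasses S 1 :=
      lefschetzOneOne_rational_holds hS.isSmoothProjective _ hcrat hc11
    have h1 := hconj (η.symm fun i => (w i : ℂ))
    rw [ht_N _ hcalg, map_zero, map_zero, η.apply_symm_apply, ← hw, hσσ', thetaC_ratCast] at h1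
    funext i
    have h2 := congrFun h1 i
    simp only [Pi.zero_apply] at h2
    exact_mod_cast h2.symm
  -- (d) the spread family on `S'` and its cycle
  obtain ⟨F'⟩ := hDom S' hS' η' p' (σ x) e' hθsa ⟨hp'0, ⟨hp'int, hp'gen, hη'int, hη'cup, h20', hline'⟩, hPer'⟩
    heig hgenσ
  obtain ⟨γ', hγ'alg, hγ'⟩ := F'.exists_algebraicClass'
  -- (e) Buskin for `ψ = η'⁻¹ σ η` and `φ = η⁻¹ σ' η'`
  have hμ : complexOrientationFamily.HasPoincareDuality := OrientationFamily.hasPoincareDuality _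
  have hσ1 : ∀ a b, k3Form (σ a) (σ b) = 1 * k3Form a b := fun a b => by rw [hσ, one_mul]
  have hσ'1 : ∀ a b, k3Form (σ' a) (σ' b) = 1 * k3Form a b := fun a b => by rw [hσ', one_mul]
  obtain ⟨γψ, hγψ, hψeq⟩ := hB complexOrientationFamily hμ S' S hS' hS p' p ⟨hp'int, hp'gen⟩ ⟨hpint, hpgen⟩
    (η'.symm.toLinearMap ∘ₗ σ ∘ₗ η.toLinearMap)
    (fun y hy => by
      simp only [LinearMap.comp_apply, LinearEquiv.coe_coe]
      exact isRationalClass_markingConj η' η σ hS' hS hη'int hηint hσrat hy)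
    (fun i j y hy => by
      simp only [LinearMap.comp_apply, LinearEquiv.coe_coe]
      exact isOfHodgeType_markingConj η' p' (σ x) η p x σ hHT hS' hS hη'int hη'cup h20' hx'pos hηint hηcup
        hp0 h20 hxpos hσrat one_ne_zero hσ1 ⟨1, (one_smul ℂ (σ x)).symm⟩ i j y hy)
    (fun a b c hc => by
      simp only [LinearMap.comp_apply, LinearEquiv.coe_coe]
      have h1 := cupProduct_markingConj η' p' η p σ hp0 hη'cup hηcup hσ1 a b c hc
      rwa [one_mul] at h1)
  obtain ⟨γφ, hγφ, hφeq⟩ := hB complexOrientationFamily hμ S S' hS hS' p p' ⟨hpint, hpgen⟩ ⟨hp'int, hp'gen⟩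
    (η.symm.toLinearMap ∘ₗ σ' ∘ₗ η'.toLinearMap)
    (fun y hy => by
      simp only [LinearMap.comp_apply, LinearEquiv.coe_coe]
      exact isRationalClass_markingConj η η' σ' hS hS' hηint hη'int hσ'rat hy)
    (fun i j y hy => by
      simp only [LinearMap.comp_apply, LinearEquiv.coe_coe]
      exact isOfHodgeType_markingConj η p x η' p' (σ x) σ' hHT hS hS' hηint hηcup h20 hxpos hη'int hη'cup
        hp'0 h20' hx'pos hσ'rat one_ne_zero hσ'1 ⟨1, by rw [hσ'σ, one_smul]⟩ i j y hy)
    (fun a b c hc => by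
      simp only [LinearMap.comp_apply, LinearEquiv.coe_coe]
      have h1 := cupProduct_markingConj η p η' p' σ' hp'0 hηcup hη'cup hσ'1 a b c hc
      rwa [one_mul] at h1)
  -- (f) compose the three correspondences
  have hCUP := SquareOfGenerator.cupProduct_mem_algebraicClasses_tripleProduct
  obtain ⟨γ₁, hγ₁, hγ₁eq⟩ := corrComp_K3_of_cup complexOrientationFamily hCUP S' S' S hS' hS' hS γ' hγ'alg γψ hγψ
  obtain ⟨γ₂, hγ₂, hγ₂eq⟩ := corrComp_K3_of_cup complexOrientationFamily hCUP S S' S hS hS' hS γφ hγφ γ₁ hγ₁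
  -- (g) `t = φ ∘ t' ∘ ψ` is induced by `γ₂`; Varesco's bookkeeping concludes
  refine SquareOfGenerator.squareOfGenerator S hS.isSmoothProjective t ht_rat ht_N ⟨γ₂, hγ₂, fun y => ?_⟩ hgen
  have key : t y = (η.symm.toLinearMap ∘ₗ σ' ∘ₗ η'.toLinearMap)
      ((η'.symm.toLinearMap ∘ₗ (thetaC θ ∘ₗ η'.toLinearMap))
        ((η'.symm.toLinearMap ∘ₗ σ ∘ₗ η.toLinearMap) y)) := by
    simp only [LinearMap.comp_apply, LinearEquiv.coe_coe, LinearEquiv.apply_symm_apply]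
    rw [← hconj, hσ'σ, LinearEquiv.symm_apply_apply]
  rw [key, hφeq, hγ', hψeq, ← hγ₁eq, ← hγ₂eq]

end Summit.HodgeConjecture.HodgeConjecture.Theorems.MarkmanPartnerTransport.RMTypeDescent

end
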